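import Mathlib.Geometry.Manifold.WhitneyEmbedding
import Literature.Topology.FourManifolds.PontryaginThomCollapse
import HarnessLib

/-!
# Closed manifolds embed in round spheres of large codimension (Whitney); Kervaire–Milnor Lemma 3.3

Trunk T-4MAN (`Literature/Topology/FourManifolds`). Fourth layer, under conjunct (B-b), of the
decomposition of the named fact `Literature.Topology.FourManifolds.exists_commGroup_homotopySphereClass_isCyclic_seven`
(`HCobordism.lean`; `Θ₇` is cyclic): the named fact
`Literature.Topology.FourManifolds.exists_isSmoothEmbedding_isNormalFraming_of_isStablyParallelizable`
(`PontryaginThomCollapse.lean`; Kervaire–Milnor 1963, p. 510: an s-parallelizable closed `Mⁿ`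
embeds in `Sⁿ⁺ᵏ`, `k > n + 1`, with a normal framing, by Whitney's embedding theorem and
Lemma 3.3) is split into

* **Whitney** (proved, `Literature.Topology.FourManifolds.exists_injective_immersion_sphere`): every compact Hausdorff `C^∞`
  manifold modelled on `ℝⁿ` admits, for some `k > n + 1`, an injective `C^∞` map `M → 𝕊ⁿ⁺ᵏ`
  with injective differential everywhere — Mathlib's Whitney embedding theorem
  (`exists_embedding_euclidean_of_compact`: `M ↪ ℝᴺ`), followed by the zero-padding
  `ℝᴺ ⊆ ℝⁿ⁺ᵏ` (`Literature.Topology.FourManifolds.euclideanPad`) and the inverse stereographic projection `ℝⁿ⁺ᵏ → 𝕊ⁿ⁺ᵏ`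
  (`Literature.Topology.FourManifolds.stereoInv`, the inverse of a chart of the sphere);
* **Kervaire–Milnor's Lemma 3.3** (named fact,
  `Literature.Topology.FourManifolds.exists_isNormalFraming_of_isStablyParallelizable`, p. 509: "Let `M` be an
  `n`-dimensional submanifold of `Sⁿ⁺ᵏ`, `n < k`. Then `M` is s-parallelizable if and only if
  its normal bundle is trivial", direction `⇒`): the normal
  bundle of an s-parallelizable compact submanifold of `𝕊ⁿ⁺ᵏ`, `n < k`, has a framing
  (`Literature.Topology.FourManifolds.IsNormalFraming`, `FramedTubularNbhd.lean`);

and reassembled (`Literature.Topology.FourManifolds.exists_isSmoothEmbedding_isNormalFraming_of_isStablyParallelizable_of`,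
proved; the packaging of an injective immersion with a normal framing as a
`Manifold.IsSmoothEmbedding` is the tree's `IsNormalFraming.isSmoothEmbedding_of_injective`) in the
form "for some `k > n + 1`" which is all that §4 uses. The glue
`Literature.Topology.FourManifolds.HomotopySphere.boundsParallelizable_of_isStablyParallelizable_seven_of'` proves Kervaire–Milnor
§4 at `n = 7` from Lemma 3.3, Lemma 4.2 (`boundsParallelizable_of_collapseNullHomotopic`) and
`0 ∈ p(Σ)` (`HomotopySphere.exists_collapseNullHomotopic_seven`), Whitney's theorem and the tubular
neighbourhood theorem being proved in the tree.

## References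

* M. Kervaire, J. Milnor, *Groups of homotopy spheres I*, Ann. of Math. 77 (1963), §3, Lemma 3.3
  (p. 509) and its proof (from Lemma 3.5); §4, p. 510 ("choose an imbedding
  `i : M → Sⁿ⁺ᵏ` with `k > n + 1`. Such an imbedding exists"). [KervaireMilnorAnnals1963]
* A. Kosinski, *Differential Manifolds* (1993), II (3.1): a compact smooth manifold can be
  imbedded in a Euclidean space (the version of Whitney's theorem proved in Mathlib,
  `Mathlib.Geometry.Manifold.WhitneyEmbedding`). [Kosinski1993]
-/

open scoped Manifold ContDiff Topology
open Set Function Module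

noncomputable section

namespace Literature.Topology.FourManifolds

/-- Local notation: `𝔼 n` is the model Euclidean space `EuclideanSpace ℝ (Fin n)`. -/
local notation "𝔼 " n:arg => EuclideanSpace ℝ (Fin n)

/-- Local notation: `𝕊 n` is the unit sphere in `EuclideanSpace ℝ (Fin (n + 1))`. -/
local notation "𝕊 " n:arg => (Metric.sphere (0 : EuclideanSpace ℝ (Fin (n + 1))) 1)

-- `Fact (finrank ℝ ℝᵐ⁺¹ = m + 1)` (from `ClosedBall.lean`), the typeclass assumption under which
-- Mathlib's `stereographic'` and the tree's `IsNormalFraming` are written.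
attribute [local instance] fact_finrank_euclideanSpace_succ

/-! ### Padding `ℝᵃ ⊆ ℝᵇ` by zeros -/

/-- **Zero-padding** `ℝᵃ → ℝᵇ`, `a ≤ b`: the continuous linear map extending a vector by zeros
(coordinate `i < a` of the image is the `i`-th coordinate of the argument, the others vanish).
[folklore] -/
def euclideanPad {a b : ℕ} (_h : a ≤ b) : 𝔼 a →L[ℝ] 𝔼 b :=
  ((EuclideanSpace.equiv (Fin b) ℝ).symm : (Fin b → ℝ) →L[ℝ] 𝔼 b).comp
    ((ContinuousLinearMap.pi fun i : Fin b =>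
        if hi : (i : ℕ) < a then ContinuousLinearMap.proj (R := ℝ) (φ := fun _ : Fin a => ℝ) ⟨i, hi⟩
        else 0).comp
      ((EuclideanSpace.equiv (Fin a) ℝ) : 𝔼 a →L[ℝ] (Fin a → ℝ)))

/-- The padding reproduces the coordinates `i < a`. [folklore] -/
theorem euclideanPad_apply_castLE {a b : ℕ} (h : a ≤ b) (u : 𝔼 a) (j : Fin a) :
    euclideanPad h u (Fin.castLE h j) = u j := by
  simp [euclideanPad]

/-- The padding is injective. [folklore] -/
theorem euclideanPad_injective {a b : ℕ} (h : a ≤ b) : Injective (euclideanPad h) := by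
  intro u v huv
  ext j
  have := congrArg (fun w : 𝔼 b => w (Fin.castLE h j)) huv
  simpa only [euclideanPad_apply_castLE] using this

/-! ### The inverse stereographic projection `ℝᵐ → 𝕊ᵐ` -/

/-- The north pole `e₀ ∈ 𝕊ᵐ`. [folklore] -/
def sphereNorthPole (m : ℕ) : 𝕊 m := ⟨EuclideanSpace.single 0 1, by simp⟩

/-- The **inverse stereographic projection** `ℝᵐ → 𝕊ᵐ` onto the complement of the south pole:
the inverse of Mathlib's chart of `𝕊ᵐ` at the north pole (`stereographic'` from `-e₀`).
[folklore] -/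
def stereoInv (m : ℕ) : 𝔼 m → 𝕊 m := (chartAt (𝔼 m) (sphereNorthPole m)).symm

/-- The chart of `𝕊ᵐ` at the north pole (stereographic projection from the south pole) has
target all of `ℝᵐ` (Mathlib, `stereographic'_target`). [folklore] -/
theorem chartAt_sphereNorthPole_target (m : ℕ) :
    (chartAt (𝔼 m) (sphereNorthPole m)).target = univ :=
  stereographic'_target (-sphereNorthPole m)

/-- The inverse stereographic projection `ℝᵐ → 𝕊ᵐ` is `C^∞` (inverse of a chart of the
analytic atlas of the sphere). [folklore] -/
theorem contMDiff_stereoInv (m : ℕ) : ContMDiff (𝓡 m) (𝓡 m) ∞ (stereoInv m) := by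
  have := contMDiffOn_chart_symm (I := 𝓡 m) (n := ∞) (x := sphereNorthPole m)
  rw [chartAt_sphereNorthPole_target] at this
  exact contMDiffOn_univ.mp this

/-- The inverse stereographic projection is injective. [folklore] -/
theorem stereoInv_injective (m : ℕ) : Injective (stereoInv m) := by
  have := (chartAt (𝔼 m) (sphereNorthPole m)).symm.injOn
  rw [OpenPartialHomeomorph.symm_source, chartAt_sphereNorthPole_target] at this
  exact Set.injOn_univ.mp this

/-- The inverse stereographic projection has injective differential everywhere (inverse of a
chart). [folklore] -/
theorem injective_mfderiv_stereoInv (m : ℕ) (u : 𝔼 m) :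
    Injective (mfderiv (𝓡 m) (𝓡 m) (stereoInv m) u) :=
  (mdifferentiable_chart (I := 𝓡 m) (sphereNorthPole m)).symm.mfderiv_injective
    (by rw [OpenPartialHomeomorph.symm_source, chartAt_sphereNorthPole_target]; exact mem_univ u)

/-! ### Whitney: a closed manifold embeds in a round sphere of large codimension -/

variable {n : ℕ} {M : Type*} [TopologicalSpace M] [ChartedSpace (𝔼 n) M] [IsManifold (𝓡 n) ∞ M]
  [T2Space M] [CompactSpace M]

/-- **A compact manifold embeds in a round sphere of large codimension** (Whitney): for a
compact Hausdorff `C^∞` manifold `M` modelled on `ℝⁿ` there are `k > n + 1` and an injective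
`C^∞` map `f : M → 𝕊ⁿ⁺ᵏ` with injective differential at every point (an injective immersion,
hence — `M` being compact — an embedding). Proof: Mathlib's Whitney embedding theorem
`exists_embedding_euclidean_of_compact` gives such a map `e : M → ℝᴺ`; pad by zeros into
`ℝⁿ⁺ᵏ`, `k = N + n + 2`, and compose with the inverse stereographic projection, both injective
with injective differential (chain rule `mfderiv_comp`). Kervaire–Milnor 1963, p. 510: "choose an
imbedding `i : M → Sⁿ⁺ᵏ` with `k > n + 1`. Such an imbedding exists"; Kosinski II (3.1).
[cite: Kosinski1993, II (3.1)] -/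
theorem exists_injective_immersion_sphere :
    ∃ k : ℕ, n + 1 < k ∧ ∃ f : M → 𝕊 (n + k), ContMDiff (𝓡 n) (𝓡 (n + k)) ∞ f ∧ Injective f ∧
      ∀ x, Injective (mfderiv (𝓡 n) (𝓡 (n + k)) f x) := by
  obtain ⟨N, e, he, hemb, he'⟩ := exists_embedding_euclidean_of_compact (I := 𝓡 n) (M := M)
  refine ⟨N + n + 2, by omega, ?_⟩
  have hle : N ≤ n + (N + n + 2) := by omega
  let L := euclideanPad hle
  let f : M → 𝕊 (n + (N + n + 2)) := stereoInv _ ∘ L ∘ e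
  have hL : ContMDiff 𝓘(ℝ, 𝔼 N) 𝓘(ℝ, 𝔼 (n + (N + n + 2))) ∞ (⇑L) := L.contMDiff
  refine ⟨f, (contMDiff_stereoInv _).comp (hL.comp he),
    (stereoInv_injective _).comp ((euclideanPad_injective hle).comp hemb.injective), fun x => ?_⟩
  have h1 : MDifferentiableAt (𝓡 n) 𝓘(ℝ, 𝔼 N) e x := (he.mdifferentiableAt (by simp))
  have h2 : MDifferentiableAt 𝓘(ℝ, 𝔼 N) (𝓡 (n + (N + n + 2))) L (e x) := L.mdifferentiableAt
  have h3 : MDifferentiableAt (𝓡 (n + (N + n + 2))) (𝓡 (n + (N + n + 2))) (stereoInv _) (L (e x)) :=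
    (contMDiff_stereoInv _).mdifferentiableAt (by simp)
  have hcomp : mfderiv (𝓡 n) (𝓡 (n + (N + n + 2))) f x =
      (mfderiv (𝓡 (n + (N + n + 2))) (𝓡 (n + (N + n + 2))) (stereoInv _) (L (e x))).comp
        ((mfderiv 𝓘(ℝ, 𝔼 N) 𝓘(ℝ, 𝔼 (n + (N + n + 2))) L (e x)).comp
          (mfderiv (𝓡 n) 𝓘(ℝ, 𝔼 N) e x)) := by
    rw [show f = stereoInv _ ∘ (L ∘ e) from rfl, mfderiv_comp x h3 (h2.comp x h1),
      mfderiv_comp x h2 h1]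
    rfl
  have hLinj : Injective (mfderiv 𝓘(ℝ, 𝔼 N) 𝓘(ℝ, 𝔼 (n + (N + n + 2))) L (e x)) := by
    rw [ContinuousLinearMap.mfderiv_eq]
    exact euclideanPad_injective hle
  rw [hcomp]
  exact (injective_mfderiv_stereoInv _ _).comp (hLinj.comp (he' x))

/-! ### Kervaire–Milnor's Lemma 3.3 and the embedding-with-normal-framing fact -/

/-- **Kervaire–Milnor's Lemma 3.3, direction `⇒`** (named fact). Kervaire–Milnor, *Groups of
homotopy spheres I* (1963), p. 509: "LEMMA 3.3. Let `M` be an `n`-dimensional submanifold of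
`Sⁿ⁺ᵏ`, `n < k`. Then `M` is s-parallelizable if and only if its normal bundle is trivial."
(Proof printed ibid. from Lemma 3.5: a `k`-plane bundle over an `n`-complex, `k > n`, which is
stably trivial is trivial — obstruction theory.) Stated for a compact Hausdorff second-countable
`C^∞` manifold `M` modelled on `ℝⁿ` which is s-parallelizable (`Literature.Topology.FourManifolds.IsStablyParallelizable`,
`Spin.lean`) and an injective `C^∞` map `f : M → 𝕊ⁿ⁺ᵏ` with injective differential (whose image
is the submanifold), the conclusion being a normal framing of `f` by `k` fields in the tree's sense
(`Literature.Topology.FourManifolds.IsNormalFraming`, `FramedTubularNbhd.lean`: smooth fields along `f` tangent to the sphere and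
independent modulo `df(TM)`; with `dim M + k = n + k` this is a trivialisation of the normal bundle
`f^*T𝕊ⁿ⁺ᵏ / TM`). Not proved here: Lemma 3.5 (homotopy groups of Stiefel manifolds / obstruction
theory) is absent from Mathlib and from the tree. [cite: KervaireMilnorAnnals1963, §3, Lemma 3.3 (p. 509), with Lemma 3.5] -/
def exists_isNormalFraming_of_isStablyParallelizable : Prop :=
  ∀ (n k : ℕ) (M : Type) [TopologicalSpace M] [T2Space M] [SecondCountableTopology M]
    [CompactSpace M] [ChartedSpace (𝔼 n) M] [IsManifold (𝓡 n) ∞ M],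
    IsStablyParallelizable (𝓡 n) M → n < k → ∀ f : M → 𝕊 (n + k),
      ContMDiff (𝓡 n) (𝓡 (n + k)) ∞ f → Injective f →
      (∀ x, Injective (mfderiv (𝓡 n) (𝓡 (n + k)) f x)) →
      ∃ fr : Fin k → M → 𝔼 (n + k + 1), IsNormalFraming (𝓡 n) f fr

/-- **Kervaire–Milnor p. 510, first paragraph, for some `k > n + 1`**: an s-parallelizable closed
`n`-manifold admits, for some `k > n + 1`, a `C^∞` embedding `f : M → 𝕊ⁿ⁺ᵏ`
(`Manifold.IsSmoothEmbedding`) with a normal framing by `k` fields — from Whitney's theorem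
(`exists_injective_immersion_sphere`, proved) and Lemma 3.3
(`exists_isNormalFraming_of_isStablyParallelizable`, named fact); the injective immersion is a
`Manifold.IsSmoothEmbedding` by the tree's `IsNormalFraming.isSmoothEmbedding_of_injective` (zero
section of its tubular neighbourhood; the empty manifold is treated apart). This is the `∃ k` form
of the named fact `exists_isSmoothEmbedding_isNormalFraming_of_isStablyParallelizable`
(`PontryaginThomCollapse.lean`), which is all that §4 uses. [cite: KervaireMilnorAnnals1963, §4, p. 510 (first paragraph) with Lemma 3.3 (p. 509)] -/
theorem exists_isSmoothEmbedding_isNormalFraming_of_isStablyParallelizable_of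
    (h33 : exists_isNormalFraming_of_isStablyParallelizable)
    {n : ℕ} (M : Type) [TopologicalSpace M] [T2Space M] [SecondCountableTopology M]
    [CompactSpace M] [ChartedSpace (𝔼 n) M] [IsManifold (𝓡 n) ∞ M]
    (hM : IsStablyParallelizable (𝓡 n) M) :
    ∃ k : ℕ, n + 1 < k ∧ ∃ (f : M → 𝕊 (n + k)) (fr : Fin k → M → 𝔼 (n + k + 1)),
      Manifold.IsSmoothEmbedding (𝓡 n) (𝓡 (n + k)) ∞ f ∧ IsNormalFraming (𝓡 n) f fr := by
  obtain ⟨k, hk, f, hf, hinj, hf'⟩ := exists_injective_immersion_sphere (n := n) (M := M)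
  obtain ⟨fr, hfr⟩ := h33 n k M hM (by omega) f hf hinj hf'
  refine ⟨k, hk, f, fr, ?_, hfr⟩
  rcases isEmpty_or_nonempty M with hM0 | hM0
  · exact ⟨⟨𝔼 k, inferInstance, inferInstance, fun x => isEmptyElim x⟩,
      Topology.IsEmbedding.of_subsingleton f⟩
  · exact hfr.isSmoothEmbedding_of_injective hf hf' hinj (by rw [finrank_euclideanSpace_fin])

namespace HomotopySphere

/-- **Kervaire–Milnor §4 at `n = 7` with Whitney's theorem and tubular neighbourhoods proved**:
an s-parallelizable homotopy `7`-sphere bounds a parallelizable manifold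
(`boundsParallelizable_of_isStablyParallelizable_seven`, `HomotopySpheresBP.lean`) from the named
facts Lemma 3.3 (`exists_isNormalFraming_of_isStablyParallelizable`), Lemma 4.2
(`boundsParallelizable_of_collapseNullHomotopic`) and `0 ∈ p(Σ)`
(`exists_collapseNullHomotopic_seven`, Lemma 4.5 with `coker J₇ = 0`), the embedding into
`S⁷⁺ᵏ` (Whitney, `exists_injective_immersion_sphere`) and the trivialised tubular neighbourhood
(`nonempty_framedTubularEmbedding_of_isNormalFraming`, `FramedTubularNbhd.lean`) being proved in
the tree. Refines `boundsParallelizable_of_isStablyParallelizable_seven_of`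
(`PontryaginThomCollapse.lean`). [cite: KervaireMilnorAnnals1963, §4, pp. 510–512, with Lemma 3.3 (p. 509)] -/
theorem boundsParallelizable_of_isStablyParallelizable_seven_of'
    (h33 : exists_isNormalFraming_of_isStablyParallelizable)
    (hb : boundsParallelizable_of_collapseNullHomotopic)
    (hc : exists_collapseNullHomotopic_seven) :
    boundsParallelizable_of_isStablyParallelizable_seven := by
  intro S hS
  obtain ⟨k, hk, f, fr, hf, hfr⟩ :=
    exists_isSmoothEmbedding_isNormalFraming_of_isStablyParallelizable_of h33 S.carrier hS
  obtain ⟨E, -⟩ := nonempty_framedTubularEmbedding_of_isNormalFraming hf hfr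
  obtain ⟨E', -, hE'⟩ := hc k (by omega) S E
  exact hb 7 k S.carrier E' (by omega) hE'

end HomotopySphere

end Literature.Topology.FourManifolds
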